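import Literature.Computability.Complexity.XRayMachineCells
import HarnessLib

/-!
# The reduction `1-IN-3-SAT → 2D-X-RAY` on codes, III: the three X-ray lists

Third machine file for `GGP1999_circuitBoard`. With the list of coded incidences `Tcode` of the
ladder complex at hand (`tcodeF`, `XRayMachineCells.lean`), the three marginal vectors
`(μ, ν, ρ)` of the instance `xrayOf φ = ladderInstance n (rename φ)` (`OneInThreeSATRename.lean`;
`CellFrame.mu/nu/rho`, `TomographyCellComplex.lean`) are tabulated entry by entry: on the piece
argument `⟨⟨w, Tcode⟩, 1ᶻ⟩` the decoding formulas of `mu`, `nu`, `rho` are unary arithmetic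
(`divModFn`, `modLenFn`, `dropFn`, `ltLenF`), the predicates `ColUsed`/`RowUsed`/`CellUsed` —
literally "some incidence of `T` has the given two coordinates" — are `anyFn` scans of `Tcode`
(`usedQ`), and the cell sum `sigma` is its closed form with the complementary-pair test `hasPairF`
on the clause code. Results:

* number bricks `mOf`, `AOf`, `m2Of`, `WOf`, `UOf`, `R1Of` (the frame's `m`, `A`, `m₂`, `W`, `U`,
  `r + 1` in unary) and their values;
* the entry pieces `muPiece`, `nuPiece`, `rhoPiece` with values `frame (1^{μ_z})`, `frame (1^{ν_z})`,
  `frame (1^{ρ_z})` on genuine arguments (`muPiece_parg`, `nuPiece_parg`, `rhoPiece_parg`);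
* the list folds and **`outF`**, with `outF_mem_FP` and **`outF_encode :
  outF (encode φ) = encodingTwoDXRay.encode (xrayOf φ)`** for clause lists with three literals per
  clause.

## References

* [AroraBarak2009] S. Arora, B. Barak, *Computational Complexity*, CUP 2009, §1.3, §0.1.
* [GardnerGritzmannPrangenberg1999] R. J. Gardner, P. Gritzmann, D. Prangenberg, Discrete Math.
  202 (1999) 45–71, Lemma 3.4.
* [FischerIkenmeyer2020] N. Fischer, C. Ikenmeyer, Comput. Complexity 29 (2020) 8, §6 (Problem 5,
  inputs in unary).
-/

noncomputable section

namespace Literature.Computability.Complexity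

namespace OneInThree

open _root_.Computability Polynomial Brick Ladder3 Plumb HashBricks
open Literature.Combinatorics.Enumerative.Tomography
open scoped Notation

/-! ### The frame, complex and sums of a clause list -/

/-- The cell frame of `xrayOf φ`. [folklore] -/
def frm (φ : CNF ℕ) : CellFrame := frame (varList φ).length (rename φ)

/-- The ladder complex of `xrayOf φ`. [folklore] -/
def TT (φ : CNF ℕ) : Finset Inc := T (varList φ).length (rename φ)

/-- The cell sums of `xrayOf φ`. [folklore] -/
def sg (φ : CNF ℕ) : ℕ → ℕ → ℕ := sigma (varList φ).length (rename φ)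

/-- `xrayOf` in terms of the frame. [folklore] -/
theorem xrayOf_eq (φ : CNF ℕ) :
    xrayOf φ = ((frm φ).muList (TT φ), (frm φ).nuList (TT φ), (frm φ).rhoList (TT φ) (sg φ)) := rfl

section FrameVals

variable {φ : CNF ℕ} (hφ : φ.IsThreeLiteralClauses)
include hφ

/-- `frm_A` (auxiliary). [folklore] -/
theorem frm_A : (frm φ).A = 6 * φ.length + 2 := by
  show 2 * (varList φ).length + 2 = _; rw [length_varList hφ]; ring

omit hφ in
/-- `frm_m2` (auxiliary). [folklore] -/
theorem frm_m2 : (frm φ).m2 = 2 * φ.length + 1 := by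
  show 2 * (rename φ).length + 1 = _; rw [length_rename]

/-- `frm_U` (auxiliary). [folklore] -/
theorem frm_U : (frm φ).U = (6 * φ.length + 2) * φ.length + 1 := by
  show (2 * (varList φ).length + 2) * (rename φ).length + 1 = _; rw [length_varList hφ, length_rename]; ring

/-- `frm_W` (auxiliary). [folklore] -/
theorem frm_W : (frm φ).W = (2 * φ.length + 1) * (6 * φ.length + 2) := by
  rw [CellFrame.W, frm_m2, frm_A hφ]

end FrameVals

/-! ### Number bricks (parameterised by the extractor `g` of the CNF code) -/

section Nums

variable (g : List Bool → List Bool)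

/-- `1ᵐ`. [folklore] -/
def mOf : List Bool → List Bool := fstF ∘ g
/-- `1ᴬ`, `A = 6m + 2 = 2n + 2`. [folklore] -/
def AOf : List Bool → List Bool := appendFn ∘ fanoutFn (sixF ∘ g) (fun _ => ones 2)
/-- `1^{m₂}`, `m₂ = 2m + 1`. [folklore] -/
def m2Of : List Bool → List Bool := List.cons true ∘ appendFn ∘ fanoutFn (mOf g) (mOf g)
/-- `1ᵂ`, `W = m₂ A`. [folklore] -/
def WOf : List Bool → List Bool := umulFn ∘ fanoutFn (m2Of g) (AOf g)
/-- `1ᵁ`, `U = A m + 1`. [folklore] -/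
def UOf : List Bool → List Bool := List.cons true ∘ umulFn ∘ fanoutFn (AOf g) (mOf g)
/-- `1^{r+1}`, `r + 1 = W U`. [folklore] -/
def R1Of : List Bool → List Bool := umulFn ∘ fanoutFn (WOf g) (UOf g)

variable {g}

/-- `mOf`: membership in `FP` by composition. [cite: AroraBarak2009, §1.3] -/
theorem mOf_mem_FP (hg : g ∈ FP) : mOf g ∈ FP := comp_mem_FP fstF_mem_FP hg
/-- `AOf`: membership in `FP` by composition. [cite: AroraBarak2009, §1.3] -/
theorem AOf_mem_FP (hg : g ∈ FP) : AOf g ∈ FP :=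
  comp_mem_FP appendFn_mem_FP (fanoutFn_mem_FP (comp_mem_FP sixF_mem_FP hg) (const_mem_FP _))
/-- `m2Of`: membership in `FP` by composition. [cite: AroraBarak2009, §1.3] -/
theorem m2Of_mem_FP (hg : g ∈ FP) : m2Of g ∈ FP :=
  comp_mem_FP (cons_mem_FP true) (comp_mem_FP appendFn_mem_FP (fanoutFn_mem_FP (mOf_mem_FP hg) (mOf_mem_FP hg)))
/-- `WOf`: membership in `FP` by composition. [cite: AroraBarak2009, §1.3] -/
theorem WOf_mem_FP (hg : g ∈ FP) : WOf g ∈ FP := comp_mem_FP umulFn_mem_FP (fanoutFn_mem_FP (m2Of_mem_FP hg) (AOf_mem_FP hg))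
/-- `UOf`: membership in `FP` by composition. [cite: AroraBarak2009, §1.3] -/
theorem UOf_mem_FP (hg : g ∈ FP) : UOf g ∈ FP :=
  comp_mem_FP (cons_mem_FP true) (comp_mem_FP umulFn_mem_FP (fanoutFn_mem_FP (AOf_mem_FP hg) (mOf_mem_FP hg)))
/-- `R1Of`: membership in `FP` by composition. [cite: AroraBarak2009, §1.3] -/
theorem R1Of_mem_FP (hg : g ∈ FP) : R1Of g ∈ FP := comp_mem_FP umulFn_mem_FP (fanoutFn_mem_FP (WOf_mem_FP hg) (UOf_mem_FP hg))

variable {φ : CNF ℕ} (hφ : φ.IsThreeLiteralClauses) {q : List Bool} (hq : g q = encodingCNF.encode φ)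
include hq

/-- Value of `mOf` on a genuine argument. [folklore] -/
theorem mOf_val : mOf g q = ones φ.length := by
  rw [mOf, Function.comp_apply, hq, encodeCNF_eq, fstF_boolPair]

include hφ in
/-- Value of `AOf` on a genuine argument. [folklore] -/
theorem AOf_val : AOf g q = ones (frm φ).A := by
  have h6 : sixF (encodingCNF.encode φ) = ones (6 * φ.length) := by
    have hf : fstF (encodingCNF.encode φ) = ones φ.length := by rw [encodeCNF_eq, fstF_boolPair]
    simp only [sixF, Function.comp_apply, fanoutFn_apply, hf, appendFn_boolPair, ones, ← List.replicate_add]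
    congr 1; omega
  rw [AOf, Function.comp_apply, fanoutFn_apply, Function.comp_apply, hq, h6, appendFn_boolPair, frm_A hφ, ones, ones,
    ← List.replicate_add]

/-- Value of `m2Of` on a genuine argument. [folklore] -/
theorem m2Of_val : m2Of g q = ones (frm φ).m2 := by
  simp only [m2Of, Function.comp_apply, fanoutFn_apply, mOf_val hq, appendFn_boolPair, frm_m2, ones, ← List.replicate_add,
    ← List.replicate_succ]
  congr 1; omega

include hφ in
/-- Value of `WOf` on a genuine argument. [folklore] -/
theorem WOf_val : WOf g q = ones (frm φ).W := by
  rw [WOf, Function.comp_apply, fanoutFn_apply, m2Of_val hq, AOf_val hφ hq, umulFn_boolPair]; rfl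

include hφ in
/-- Value of `UOf` on a genuine argument. [folklore] -/
theorem UOf_val : UOf g q = ones (frm φ).U := by
  rw [UOf, Function.comp_apply, Function.comp_apply, fanoutFn_apply, AOf_val hφ hq, mOf_val hq, umulFn_boolPair,
    frm_U hφ, frm_A hφ]
  rfl

include hφ in
/-- Value of `R1Of` on a genuine argument. [folklore] -/
theorem R1Of_val : R1Of g q = ones ((frm φ).r + 1) := by
  rw [R1Of, Function.comp_apply, fanoutFn_apply, WOf_val hφ hq, UOf_val hφ hq, umulFn_boolPair, CellFrame.r_succ]

end Nums

/-! ### The piece argument `⟨⟨w, Tcode⟩, 1ᶻ⟩` -/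

/-- The context `⟨w, Tcode⟩` of the list folds. [folklore] -/
def ctxF : List Bool → List Bool := fanoutFn id tcodeF

/-- On the piece argument: `w`. [folklore] -/
def gQ : List Bool → List Bool := fstF ∘ fstF
/-- On the piece argument: `Tcode`. [folklore] -/
def tcQ : List Bool → List Bool := sndF ∘ fstF
/-- On the piece argument: `1ᶻ`. [folklore] -/
def zQ : List Bool → List Bool := sndF

/-- The genuine context and piece argument. [folklore] -/
def ctx (φ : CNF ℕ) : List Bool := boolPair (encodingCNF.encode φ) (encList (allItems φ))

/-- The genuine piece argument. [folklore] -/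
def parg (φ : CNF ℕ) (z : ℕ) : List Bool := boolPair (ctx φ) (ones z)

/-- Value of `ctxF` on a genuine argument. [folklore] -/
theorem ctxF_encode {φ : CNF ℕ} (hφ : φ.IsThreeLiteralClauses) : ctxF (encodingCNF.encode φ) = ctx φ := by
  rw [ctxF, fanoutFn_apply, id, tcodeF_encode hφ]; rfl

/-- Value of `gQ` on a genuine argument. [folklore] -/
theorem gQ_parg (φ : CNF ℕ) (z : ℕ) : gQ (parg φ z) = encodingCNF.encode φ := by simp [gQ, parg, ctx]
/-- Value of `tcQ` on a genuine argument. [folklore] -/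
theorem tcQ_parg (φ : CNF ℕ) (z : ℕ) : tcQ (parg φ z) = encList (allItems φ) := by simp [tcQ, parg, ctx]
/-- Value of `zQ` on a genuine argument. [folklore] -/
theorem zQ_parg (φ : CNF ℕ) (z : ℕ) : zQ (parg φ z) = ones z := by simp [zQ, parg]

/-- `ctxF`: membership in `FP` by composition. [cite: AroraBarak2009, §1.3] -/
theorem ctxF_mem_FP : ctxF ∈ FP := fanoutFn_mem_FP (PolyTimeComputable.id _) tcodeF_mem_FP
/-- `gQ`: membership in `FP` by composition. [cite: AroraBarak2009, §1.3] -/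
theorem gQ_mem_FP : gQ ∈ FP := comp_mem_FP fstF_mem_FP fstF_mem_FP
/-- `tcQ`: membership in `FP` by composition. [cite: AroraBarak2009, §1.3] -/
theorem tcQ_mem_FP : tcQ ∈ FP := comp_mem_FP sndF_mem_FP fstF_mem_FP

/-! ### Scanning the incidence list: `ColUsed`, `RowUsed`, `CellUsed` -/

/-- On `⟨⟨1ᵃ, 1ᵇ⟩, item⟩`: equality of a field of the item with a field of the query (one-bit).
[folklore] -/
def fieldEqF (fi fq : List Bool → List Bool) : List Bool → List Bool := eqPairFn ∘ fanoutFn (fi ∘ sndF) (fq ∘ fstF)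

/-- "item `(s,u,i)` has `s = a` and `i = b`". [folklore] -/
def colTest : List Bool → List Bool := andFn (fieldEqF fstF fstF) (fieldEqF (sndF ∘ sndF) sndF)
/-- "item has `u = a` and `i = b`". [folklore] -/
def rowTest : List Bool → List Bool := andFn (fieldEqF (fstF ∘ sndF) fstF) (fieldEqF (sndF ∘ sndF) sndF)
/-- "item has `s = a` and `u = b`". [folklore] -/
def cellTest : List Bool → List Bool := andFn (fieldEqF fstF fstF) (fieldEqF (fstF ∘ sndF) sndF)

/-- `colTest` is one-bit on every input. [folklore] -/
theorem oneBit_colTest : OneBit colTest := oneBit_andFn (oneBit_eqPairFn.comp _) (oneBit_eqPairFn.comp _)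
/-- `rowTest` is one-bit on every input. [folklore] -/
theorem oneBit_rowTest : OneBit rowTest := oneBit_andFn (oneBit_eqPairFn.comp _) (oneBit_eqPairFn.comp _)
/-- `cellTest` is one-bit on every input. [folklore] -/
theorem oneBit_cellTest : OneBit cellTest := oneBit_andFn (oneBit_eqPairFn.comp _) (oneBit_eqPairFn.comp _)

/-- `fieldEqF`: membership in `FP` by composition. [cite: AroraBarak2009, §1.3] -/
theorem fieldEqF_mem_FP {fi fq : List Bool → List Bool} (hi : fi ∈ FP) (hq : fq ∈ FP) : fieldEqF fi fq ∈ FP :=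
  comp_mem_FP eqPairFn_mem_FP (fanoutFn_mem_FP (comp_mem_FP hi sndF_mem_FP) (comp_mem_FP hq fstF_mem_FP))
/-- `colTest`: membership in `FP` by composition. [cite: AroraBarak2009, §1.3] -/
theorem colTest_mem_FP : colTest ∈ FP :=
  andFn_mem_FP (fieldEqF_mem_FP fstF_mem_FP fstF_mem_FP) (fieldEqF_mem_FP (comp_mem_FP sndF_mem_FP sndF_mem_FP) sndF_mem_FP)
/-- `rowTest`: membership in `FP` by composition. [cite: AroraBarak2009, §1.3] -/
theorem rowTest_mem_FP : rowTest ∈ FP :=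
  andFn_mem_FP (fieldEqF_mem_FP (comp_mem_FP fstF_mem_FP sndF_mem_FP) fstF_mem_FP)
    (fieldEqF_mem_FP (comp_mem_FP sndF_mem_FP sndF_mem_FP) sndF_mem_FP)
/-- `cellTest`: membership in `FP` by composition. [cite: AroraBarak2009, §1.3] -/
theorem cellTest_mem_FP : cellTest ∈ FP :=
  andFn_mem_FP (fieldEqF_mem_FP fstF_mem_FP fstF_mem_FP) (fieldEqF_mem_FP (comp_mem_FP fstF_mem_FP sndF_mem_FP) sndF_mem_FP)

/-- Value of a field comparison. [folklore] -/
theorem fieldEqF_val (fi fq : List Bool → List Bool) (q x : List Bool) :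
    fieldEqF fi fq (boolPair q x) = [decide (fi x = fq q)] := by
  simp only [fieldEqF, Function.comp_apply, fanoutFn_apply, sndF_boolPair, fstF_boolPair, eqPairFn_boolPair]

/-- Value of `colTest` on a genuine argument. [folklore] -/
theorem colTest_val (a b : ℕ) (t : Inc) :
    colTest (boolPair (boolPair (ones a) (ones b)) (encInc t)) = [decide (t.1 = a ∧ t.2.2 = b)] := by
  rw [colTest, andFn_apply (fieldEqF_val _ _ _ _) (fieldEqF_val _ _ _ _)]
  simp only [encInc, Function.comp_apply, fstF_boolPair, sndF_boolPair, List.replicate_left_inj, Bool.decide_and]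

/-- Value of `rowTest` on a genuine argument. [folklore] -/
theorem rowTest_val (a b : ℕ) (t : Inc) :
    rowTest (boolPair (boolPair (ones a) (ones b)) (encInc t)) = [decide (t.2.1 = a ∧ t.2.2 = b)] := by
  rw [rowTest, andFn_apply (fieldEqF_val _ _ _ _) (fieldEqF_val _ _ _ _)]
  simp only [encInc, Function.comp_apply, fstF_boolPair, sndF_boolPair, List.replicate_left_inj, Bool.decide_and]

/-- Value of `cellTest` on a genuine argument. [folklore] -/
theorem cellTest_val (a b : ℕ) (t : Inc) :
    cellTest (boolPair (boolPair (ones a) (ones b)) (encInc t)) = [decide (t.1 = a ∧ t.2.1 = b)] := by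
  rw [cellTest, andFn_apply (fieldEqF_val _ _ _ _) (fieldEqF_val _ _ _ _)]
  simp only [encInc, Function.comp_apply, fstF_boolPair, sndF_boolPair, List.replicate_left_inj, Bool.decide_and]

/-- **The scan**: `anyFn test` over `Tcode` with the query `⟨aQ, bQ⟩`. [folklore] -/
def usedQ (test aQ bQ : List Bool → List Bool) : List Bool → List Bool := anyFn test ∘ fanoutFn (fanoutFn aQ bQ) tcQ

/-- `usedQ`: membership in `FP` by composition. [cite: AroraBarak2009, §1.3] -/
theorem usedQ_mem_FP {test aQ bQ : List Bool → List Bool} (ht : test ∈ FP) (hob : OneBit test) (ha : aQ ∈ FP)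
    (hb : bQ ∈ FP) : usedQ test aQ bQ ∈ FP :=
  comp_mem_FP (anyFn_mem_FP ht hob) (fanoutFn_mem_FP (fanoutFn_mem_FP ha hb) tcQ_mem_FP)

/-- `usedQ` is one-bit on every input. [folklore] -/
theorem oneBit_usedQ {test : List Bool → List Bool} (hob : OneBit test) (aQ bQ : List Bool → List Bool) :
    OneBit (usedQ test aQ bQ) := (oneBit_anyFn hob).comp _

/-- **Value of the scan** on a genuine piece argument: "some incidence of the ladder complex passes
the test". [folklore] -/
theorem usedQ_val {test : List Bool → List Bool} (hob : OneBit test) {P : ℕ → ℕ → Inc → Prop}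
    [∀ a b t, Decidable (P a b t)]
    (hval : ∀ a b t, test (boolPair (boolPair (ones a) (ones b)) (encInc t)) = [decide (P a b t)])
    {aQ bQ : List Bool → List Bool} {φ : CNF ℕ} {z a b : ℕ} (ha : aQ (parg φ z) = ones a) (hb : bQ (parg φ z) = ones b) :
    usedQ test aQ bQ (parg φ z) = [decide (∃ t ∈ TT φ, P a b t)] := by
  rw [usedQ, Function.comp_apply, fanoutFn_apply, fanoutFn_apply, ha, hb, tcQ_parg, anyFn_boolPair hob, decNil_encList]
  congr 1
  apply Bool.decide_congr
  constructor
  · rintro ⟨x, hx, h⟩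
    obtain ⟨t, ht, rfl⟩ := mem_allItems_iff.1 hx
    rw [hval] at h
    exact ⟨t, ht, by simpa using h⟩
  · rintro ⟨t, ht, h⟩
    exact ⟨encInc t, mem_allItems_iff.2 ⟨t, ht, rfl⟩, by rw [hval]; simpa using h⟩

/-! ### The entry pieces -/

/-- The code of a list entry `e`: `frame 1ᵉ`. [folklore] -/
def fr (e : ℕ) : List Bool → List Bool := fun _ => Ladder3.frame (ones e)

/-- `fr`: membership in `FP` by composition. [cite: AroraBarak2009, §1.3] -/
theorem fr_mem_FP (e : ℕ) : fr e ∈ FP := const_mem_FP _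

/-- `⟨1^{z / A}, 1^{z mod A}⟩`. [folklore] -/
def dmAQ : List Bool → List Bool := divModFn ∘ fanoutFn (AOf gQ) zQ
/-- `⟨1^{z / W}, 1^{z mod W}⟩`. [folklore] -/
def dmWQ : List Bool → List Bool := divModFn ∘ fanoutFn (WOf gQ) zQ

/-- **The `μ` piece**: `frame 1^{μ_z}`, `μ_z = [ColUsed T (z/A) (z mod A)]`. [folklore] -/
def muPiece : List Bool → List Bool := iteFn (usedQ colTest (fstF ∘ dmAQ) (sndF ∘ dmAQ)) (fr 1) (fr 0)

/-- `1^{U - 1 - z/W}` (monus). [folklore] -/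
def uQ : List Bool → List Bool := dropFn ∘ fanoutFn (List.cons true ∘ fstF ∘ dmWQ) (UOf gQ)
/-- `1^{A - 1 - z mod W}` (monus). [folklore] -/
def iQ : List Bool → List Bool := dropFn ∘ fanoutFn (List.cons true ∘ sndF ∘ dmWQ) (AOf gQ)

/-- **The `ν` piece**: `frame 1^{ν_z}`,
`ν_z = [z/W < U ∧ z mod W < A ∧ RowUsed T (U-1-z/W) (A-1-z mod W)]`. [folklore] -/
def nuPiece : List Bool → List Bool :=
  iteFn (andFn (ltLenF ∘ fanoutFn (fstF ∘ dmWQ) (UOf gQ)) (andFn (ltLenF ∘ fanoutFn (sndF ∘ dmWQ) (AOf gQ))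
    (usedQ rowTest uQ iQ))) (fr 1) (fr 0)

/-- `1^{(z mod W) / A}`. [folklore] -/
def s'Q : List Bool → List Bool := fstF ∘ divModFn ∘ fanoutFn (AOf gQ) (sndF ∘ dmWQ)
/-- `1ˢ`, `s = m₂ - 1 - (z mod W)/A = 2m - (z mod W)/A` (monus). [folklore] -/
def sQ : List Bool → List Bool := dropFn ∘ fanoutFn s'Q (appendFn ∘ fanoutFn (mOf gQ) (mOf gQ))
/-- `1ᵘ`, `u = z / W`. [folklore] -/
def uQ' : List Bool → List Bool := fstF ∘ dmWQ
/-- `[z mod A = 0]`. [folklore] -/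
def zmodA0Q : List Bool → List Bool := isNilFn ∘ modLenFn ∘ fanoutFn (AOf gQ) zQ
/-- `[s even]`. [folklore] -/
def sEvenQ : List Bool → List Bool := isNilFn ∘ modLenFn ∘ fanoutFn (fun _ => ones 2) sQ
/-- `1^{u mod A}`. [folklore] -/
def kQ : List Bool → List Bool := modLenFn ∘ fanoutFn (AOf gQ) uQ'
/-- `[u mod A = 0]`. [folklore] -/
def k0Q : List Bool → List Bool := isNilFn ∘ kQ
/-- `[u mod A = 1]`. [folklore] -/
def k1Q : List Bool → List Bool := eqPairFn ∘ fanoutFn kQ (fun _ => [true])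
/-- `[HasPair C_{s/2}]` (the pair test on the clause code `s/2`). [folklore] -/
def hpQ : List Bool → List Bool := hasPairF ∘ nthItemFn ∘ fanoutFn (halfFn ∘ sQ) (sndF ∘ gQ)

/-- **The `σ` piece**: `frame 1^{σ(s,u)}` by the closed form of `sigma`. [folklore] -/
def sigmaPiece : List Bool → List Bool :=
  iteFn sEvenQ (iteFn k1Q (iteFn hpQ (fr 1) (fr 2)) (fr 1))
    (iteFn k0Q (fr 2) (iteFn k1Q (iteFn hpQ (fr 0) (fr 1)) (fr 1)))

/-- **The `ρ` piece**: `frame 1^{ρ_z}`, `ρ_z = if z mod A = 0 ∧ CellUsed T s u then σ(s,u) else 0`.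
[folklore] -/
def rhoPiece : List Bool → List Bool := iteFn (andFn zmodA0Q (usedQ cellTest sQ uQ')) sigmaPiece (fr 0)

/-! ### Membership in `FP` of the pieces -/

/-- `dmAQ`: membership in `FP` by composition. [cite: AroraBarak2009, §1.3] -/
theorem dmAQ_mem_FP : dmAQ ∈ FP := comp_mem_FP divModFn_mem_FP (fanoutFn_mem_FP (AOf_mem_FP gQ_mem_FP) sndF_mem_FP)
/-- `dmWQ`: membership in `FP` by composition. [cite: AroraBarak2009, §1.3] -/
theorem dmWQ_mem_FP : dmWQ ∈ FP := comp_mem_FP divModFn_mem_FP (fanoutFn_mem_FP (WOf_mem_FP gQ_mem_FP) sndF_mem_FP)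

/-- `muPiece ∈ FP`. [cite: AroraBarak2009, §1.3] -/
theorem muPiece_mem_FP : muPiece ∈ FP :=
  iteFn_mem_FP (usedQ_mem_FP colTest_mem_FP oneBit_colTest (comp_mem_FP fstF_mem_FP dmAQ_mem_FP)
    (comp_mem_FP sndF_mem_FP dmAQ_mem_FP)) (fr_mem_FP 1) (fr_mem_FP 0)

/-- `uQ`: membership in `FP` by composition. [cite: AroraBarak2009, §1.3] -/
theorem uQ_mem_FP : uQ ∈ FP :=
  comp_mem_FP dropFn_mem_FP (fanoutFn_mem_FP (comp_mem_FP (cons_mem_FP true) (comp_mem_FP fstF_mem_FP dmWQ_mem_FP))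
    (UOf_mem_FP gQ_mem_FP))
/-- `iQ`: membership in `FP` by composition. [cite: AroraBarak2009, §1.3] -/
theorem iQ_mem_FP : iQ ∈ FP :=
  comp_mem_FP dropFn_mem_FP (fanoutFn_mem_FP (comp_mem_FP (cons_mem_FP true) (comp_mem_FP sndF_mem_FP dmWQ_mem_FP))
    (AOf_mem_FP gQ_mem_FP))

/-- `nuPiece ∈ FP`. [cite: AroraBarak2009, §1.3] -/
theorem nuPiece_mem_FP : nuPiece ∈ FP :=
  iteFn_mem_FP (andFn_mem_FP (comp_mem_FP ltLenF_mem_FP (fanoutFn_mem_FP (comp_mem_FP fstF_mem_FP dmWQ_mem_FP)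
      (UOf_mem_FP gQ_mem_FP))) (andFn_mem_FP (comp_mem_FP ltLenF_mem_FP (fanoutFn_mem_FP
      (comp_mem_FP sndF_mem_FP dmWQ_mem_FP) (AOf_mem_FP gQ_mem_FP))) (usedQ_mem_FP rowTest_mem_FP oneBit_rowTest uQ_mem_FP iQ_mem_FP)))
    (fr_mem_FP 1) (fr_mem_FP 0)

/-- `s'Q`: membership in `FP` by composition. [cite: AroraBarak2009, §1.3] -/
theorem s'Q_mem_FP : s'Q ∈ FP :=
  comp_mem_FP fstF_mem_FP (comp_mem_FP divModFn_mem_FP (fanoutFn_mem_FP (AOf_mem_FP gQ_mem_FP) (comp_mem_FP sndF_mem_FP dmWQ_mem_FP)))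
/-- `sQ`: membership in `FP` by composition. [cite: AroraBarak2009, §1.3] -/
theorem sQ_mem_FP : sQ ∈ FP :=
  comp_mem_FP dropFn_mem_FP (fanoutFn_mem_FP s'Q_mem_FP (comp_mem_FP appendFn_mem_FP
    (fanoutFn_mem_FP (mOf_mem_FP gQ_mem_FP) (mOf_mem_FP gQ_mem_FP))))
/-- `uQ'`: membership in `FP` by composition. [cite: AroraBarak2009, §1.3] -/
theorem uQ'_mem_FP : uQ' ∈ FP := comp_mem_FP fstF_mem_FP dmWQ_mem_FP
/-- `zmodA0Q`: membership in `FP` by composition. [cite: AroraBarak2009, §1.3] -/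
theorem zmodA0Q_mem_FP : zmodA0Q ∈ FP :=
  comp_mem_FP isNilFn_mem_FP (comp_mem_FP modLenFn_mem_FP (fanoutFn_mem_FP (AOf_mem_FP gQ_mem_FP) sndF_mem_FP))
/-- `sEvenQ`: membership in `FP` by composition. [cite: AroraBarak2009, §1.3] -/
theorem sEvenQ_mem_FP : sEvenQ ∈ FP :=
  comp_mem_FP isNilFn_mem_FP (comp_mem_FP modLenFn_mem_FP (fanoutFn_mem_FP (const_mem_FP _) sQ_mem_FP))
/-- `kQ`: membership in `FP` by composition. [cite: AroraBarak2009, §1.3] -/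
theorem kQ_mem_FP : kQ ∈ FP := comp_mem_FP modLenFn_mem_FP (fanoutFn_mem_FP (AOf_mem_FP gQ_mem_FP) uQ'_mem_FP)
/-- `k0Q`: membership in `FP` by composition. [cite: AroraBarak2009, §1.3] -/
theorem k0Q_mem_FP : k0Q ∈ FP := comp_mem_FP isNilFn_mem_FP kQ_mem_FP
/-- `k1Q`: membership in `FP` by composition. [cite: AroraBarak2009, §1.3] -/
theorem k1Q_mem_FP : k1Q ∈ FP := comp_mem_FP eqPairFn_mem_FP (fanoutFn_mem_FP kQ_mem_FP (const_mem_FP _))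
/-- `hpQ`: membership in `FP` by composition. [cite: AroraBarak2009, §1.3] -/
theorem hpQ_mem_FP : hpQ ∈ FP :=
  comp_mem_FP hasPairF_mem_FP (comp_mem_FP nthItemFn_mem_FP (fanoutFn_mem_FP (comp_mem_FP halfFn_mem_FP sQ_mem_FP)
    (comp_mem_FP sndF_mem_FP gQ_mem_FP)))

/-- `sigmaPiece ∈ FP`. [cite: AroraBarak2009, §1.3] -/
theorem sigmaPiece_mem_FP : sigmaPiece ∈ FP :=
  iteFn_mem_FP sEvenQ_mem_FP (iteFn_mem_FP k1Q_mem_FP (iteFn_mem_FP hpQ_mem_FP (fr_mem_FP 1) (fr_mem_FP 2)) (fr_mem_FP 1))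
    (iteFn_mem_FP k0Q_mem_FP (fr_mem_FP 2) (iteFn_mem_FP k1Q_mem_FP (iteFn_mem_FP hpQ_mem_FP (fr_mem_FP 0) (fr_mem_FP 1))
      (fr_mem_FP 1)))

/-- `rhoPiece ∈ FP`. [cite: AroraBarak2009, §1.3] -/
theorem rhoPiece_mem_FP : rhoPiece ∈ FP :=
  iteFn_mem_FP (andFn_mem_FP zmodA0Q_mem_FP (usedQ_mem_FP cellTest_mem_FP oneBit_cellTest sQ_mem_FP uQ'_mem_FP))
    sigmaPiece_mem_FP (fr_mem_FP 0)

/-! ### Values of the pieces on a genuine argument -/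

section PieceVals

variable {φ : CNF ℕ} (hφ : φ.IsThreeLiteralClauses)
include hφ

/-- Value of `dmAQ` on a genuine argument. [folklore] -/
theorem dmAQ_parg (z : ℕ) : dmAQ (parg φ z) = boolPair (ones (z / (frm φ).A)) (ones (z % (frm φ).A)) := by
  rw [dmAQ, Function.comp_apply, fanoutFn_apply, AOf_val hφ (gQ_parg φ z), zQ_parg, divModFn_boolPair]

/-- Value of `dmWQ` on a genuine argument. [folklore] -/
theorem dmWQ_parg (z : ℕ) : dmWQ (parg φ z) = boolPair (ones (z / (frm φ).W)) (ones (z % (frm φ).W)) := by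
  rw [dmWQ, Function.comp_apply, fanoutFn_apply, WOf_val hφ (gQ_parg φ z), zQ_parg, divModFn_boolPair]

omit hφ in
/-- An `if` on a decidable proposition as an `if` on its `decide`. [folklore] -/
theorem ite_decide_eq {α : Type*} (P : Prop) [Decidable P] (a b : α) :
    (if decide P = true then a else b) = if P then a else b := by
  by_cases h : P <;> simp [h]

/-- **Value of the `μ` piece**: `frame 1^{μ_z}`. [folklore] -/
theorem muPiece_parg (z : ℕ) : muPiece (parg φ z) = Ladder3.frame (ones ((frm φ).mu (TT φ) z)) := by
  classical
  have hu := usedQ_val oneBit_colTest (P := fun a b t => t.1 = a ∧ t.2.2 = b) colTest_val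
    (aQ := fstF ∘ dmAQ) (bQ := sndF ∘ dmAQ) (φ := φ) (z := z)
    (by rw [Function.comp_apply, dmAQ_parg hφ, fstF_boolPair]) (by rw [Function.comp_apply, dmAQ_parg hφ, sndF_boolPair])
  rw [muPiece, iteFn_apply hu, CellFrame.mu, ite_decide_eq]
  unfold ColUsed TT
  split_ifs <;> rfl

/-- Value of `uQ` on a genuine argument. [folklore] -/
theorem uQ_parg (z : ℕ) : uQ (parg φ z) = ones ((frm φ).U - 1 - z / (frm φ).W) := by
  rw [uQ, Function.comp_apply, fanoutFn_apply, Function.comp_apply, Function.comp_apply, dmWQ_parg hφ, fstF_boolPair,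
    UOf_val hφ (gQ_parg φ z), dropFn_boolPair, List.length_cons, List.length_replicate, ones, List.drop_replicate]
  congr 1; omega

/-- Value of `iQ` on a genuine argument. [folklore] -/
theorem iQ_parg (z : ℕ) : iQ (parg φ z) = ones ((frm φ).A - 1 - z % (frm φ).W) := by
  rw [iQ, Function.comp_apply, fanoutFn_apply, Function.comp_apply, Function.comp_apply, dmWQ_parg hφ, sndF_boolPair,
    AOf_val hφ (gQ_parg φ z), dropFn_boolPair, List.length_cons, List.length_replicate, ones, List.drop_replicate]
  congr 1; omega

/-- **Value of the `ν` piece**: `frame 1^{ν_z}`. [folklore] -/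
theorem nuPiece_parg (z : ℕ) : nuPiece (parg φ z) = Ladder3.frame (ones ((frm φ).nu (TT φ) z)) := by
  classical
  have h1 : (ltLenF ∘ fanoutFn (fstF ∘ dmWQ) (UOf gQ)) (parg φ z) = [decide (z / (frm φ).W < (frm φ).U)] := by
    rw [Function.comp_apply, fanoutFn_apply, Function.comp_apply, dmWQ_parg hφ, fstF_boolPair, UOf_val hφ (gQ_parg φ z),
      ltLenF_boolPair, List.length_replicate, List.length_replicate]
  have h2 : (ltLenF ∘ fanoutFn (sndF ∘ dmWQ) (AOf gQ)) (parg φ z) = [decide (z % (frm φ).W < (frm φ).A)] := by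
    rw [Function.comp_apply, fanoutFn_apply, Function.comp_apply, dmWQ_parg hφ, sndF_boolPair, AOf_val hφ (gQ_parg φ z),
      ltLenF_boolPair, List.length_replicate, List.length_replicate]
  have hu := usedQ_val oneBit_rowTest (P := fun a b t => t.2.1 = a ∧ t.2.2 = b) rowTest_val
    (aQ := uQ) (bQ := iQ) (φ := φ) (z := z) (uQ_parg hφ z) (iQ_parg hφ z)
  rw [nuPiece, iteFn_apply (andFn_apply h1 (andFn_apply h2 hu)), CellFrame.nu]
  unfold RowUsed TT
  rw [← Bool.decide_and, ← Bool.decide_and, ite_decide_eq]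
  split_ifs <;> rfl

/-- Value of `s'Q` on a genuine argument. [folklore] -/
theorem s'Q_parg (z : ℕ) : s'Q (parg φ z) = ones (z % (frm φ).W / (frm φ).A) := by
  rw [s'Q, Function.comp_apply, Function.comp_apply, fanoutFn_apply, Function.comp_apply, dmWQ_parg hφ, sndF_boolPair,
    AOf_val hφ (gQ_parg φ z), divModFn_boolPair, fstF_boolPair]

/-- Value of `sQ` on a genuine argument. [folklore] -/
theorem sQ_parg (z : ℕ) : sQ (parg φ z) = ones ((frm φ).m2 - 1 - z % (frm φ).W / (frm φ).A) := by
  rw [sQ, Function.comp_apply, fanoutFn_apply, s'Q_parg hφ, Function.comp_apply, fanoutFn_apply, mOf_val (gQ_parg φ z),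
    appendFn_boolPair, dropFn_boolPair, List.length_replicate, ones, ones, ← List.replicate_add, List.drop_replicate, frm_m2]
  congr 1; omega

/-- Value of `uQ'` on a genuine argument. [folklore] -/
theorem uQ'_parg (z : ℕ) : uQ' (parg φ z) = ones (z / (frm φ).W) := by
  rw [uQ', Function.comp_apply, dmWQ_parg hφ, fstF_boolPair]

/-- Value of `zmodA0Q` on a genuine argument. [folklore] -/
theorem zmodA0Q_parg (z : ℕ) : zmodA0Q (parg φ z) = [decide (z % (frm φ).A = 0)] := by
  rw [zmodA0Q, Function.comp_apply, Function.comp_apply, fanoutFn_apply, AOf_val hφ (gQ_parg φ z), zQ_parg, modLenFn_boolPair,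
    List.length_replicate, isNilFn]
  congr 1; apply Bool.decide_congr
  exact ⟨fun h => by simpa using congrArg List.length h, fun h => by rw [h]; rfl⟩

/-- Value of `sEvenQ` on a genuine argument. [folklore] -/
theorem sEvenQ_parg (z : ℕ) : sEvenQ (parg φ z) = [decide (((frm φ).m2 - 1 - z % (frm φ).W / (frm φ).A) % 2 = 0)] := by
  rw [sEvenQ, Function.comp_apply, Function.comp_apply, fanoutFn_apply, sQ_parg hφ, modLenFn_boolPair, List.length_replicate,
    isNilFn]
  congr 1; apply Bool.decide_congr
  exact ⟨fun h => by simpa using congrArg List.length h, fun h => by rw [h]; rfl⟩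

/-- Value of `kQ` on a genuine argument. [folklore] -/
theorem kQ_parg (z : ℕ) : kQ (parg φ z) = ones (z / (frm φ).W % (frm φ).A) := by
  rw [kQ, Function.comp_apply, fanoutFn_apply, AOf_val hφ (gQ_parg φ z), uQ'_parg hφ, modLenFn_boolPair, List.length_replicate]

/-- Value of `k0Q` on a genuine argument. [folklore] -/
theorem k0Q_parg (z : ℕ) : k0Q (parg φ z) = [decide (z / (frm φ).W % (frm φ).A = 0)] := by
  rw [k0Q, Function.comp_apply, kQ_parg hφ, isNilFn]
  congr 1; apply Bool.decide_congr
  exact ⟨fun h => by simpa using congrArg List.length h, fun h => by rw [h]; rfl⟩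

/-- Value of `k1Q` on a genuine argument. [folklore] -/
theorem k1Q_parg (z : ℕ) : k1Q (parg φ z) = [decide (z / (frm φ).W % (frm φ).A = 1)] := by
  rw [k1Q, Function.comp_apply, fanoutFn_apply, kQ_parg hφ, eqPairFn_boolPair]
  congr 1; apply Bool.decide_congr
  exact ⟨fun h => by simpa using congrArg List.length h, fun h => by rw [h]; rfl⟩

/-- **Value of the pair test at a used cell**: `[HasPair (rename φ)[s/2]]` when `s/2 < m`.
[folklore] -/
theorem hpQ_parg {z : ℕ} (hs : ((frm φ).m2 - 1 - z % (frm φ).W / (frm φ).A) / 2 < φ.length) :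
    hpQ (parg φ z) = [decide (HasPair ((rename φ).getD (((frm φ).m2 - 1 - z % (frm φ).W / (frm φ).A) / 2) []))] := by
  rw [hpQ, Function.comp_apply, Function.comp_apply, fanoutFn_apply, Function.comp_apply, sQ_parg hφ, halfFn, List.length_replicate,
    Function.comp_apply, gQ_parg, encodeCNF_eq, sndF_boolPair, nthItemFn_encList, List.getD_eq_getElem _ _ (by simpa using hs),
    List.getElem_map, hasPairF_encode (hφ _ (List.getElem_mem hs)).1]
  congr 1; apply Bool.decide_congr; exact (hasPair_rename_getD hs).symm

omit hφ in
/-- Column-cells of used cells are `< 2m`. [folklore] -/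
theorem lt_of_cellUsed {s u : ℕ} (h : CellUsed (TT φ) s u) : s / 2 < φ.length := by
  obtain ⟨t, ht, rfl, -⟩ := h
  obtain ⟨j, -, c, hc, h | h | h | h⟩ := mem_T_iff.1 ht <;> subst h <;>
    simp only [Pinc, Einc, Oinc, Rinc, length_rename] at hc ⊢ <;> omega

/-- **Value of the `σ` piece at a used cell**: `frame 1^{σ(s,u)}`. [folklore] -/
theorem sigmaPiece_parg {z : ℕ} (hused : CellUsed (TT φ) ((frm φ).m2 - 1 - z % (frm φ).W / (frm φ).A) (z / (frm φ).W)) :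
    sigmaPiece (parg φ z) = Ladder3.frame (ones (sg φ ((frm φ).m2 - 1 - z % (frm φ).W / (frm φ).A) (z / (frm φ).W))) := by
  have hs := lt_of_cellUsed hused
  have hA : (frm φ).A = 2 * (varList φ).length + 2 := rfl
  rw [sigmaPiece, iteFn_apply (sEvenQ_parg hφ z), sg, sigma, ← hA]
  set s := (frm φ).m2 - 1 - z % (frm φ).W / (frm φ).A
  set u := z / (frm φ).W
  by_cases he : s % 2 = 0
  · rw [decide_eq_true he, if_pos rfl, if_pos he, iteFn_apply (k1Q_parg hφ z)]
    by_cases h1 : u % (frm φ).A = 1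
    · rw [decide_eq_true h1, if_pos rfl, if_pos h1, iteFn_apply (hpQ_parg hφ hs)]
      by_cases hp : HasPair ((rename φ).getD (s / 2) [])
      · rw [decide_eq_true hp, if_pos rfl, if_pos hp]; rfl
      · rw [decide_eq_false hp, if_neg Bool.false_ne_true, if_neg hp]; rfl
    · rw [decide_eq_false h1, if_neg Bool.false_ne_true, if_neg h1]; rfl
  · rw [decide_eq_false he, if_neg Bool.false_ne_true, if_neg he, iteFn_apply (k0Q_parg hφ z)]
    by_cases h0 : u % (frm φ).A = 0
    · rw [decide_eq_true h0, if_pos rfl, if_pos h0]; rfl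
    · rw [decide_eq_false h0, if_neg Bool.false_ne_true, if_neg h0, iteFn_apply (k1Q_parg hφ z)]
      by_cases h1 : u % (frm φ).A = 1
      · rw [decide_eq_true h1, if_pos rfl, if_pos h1, iteFn_apply (hpQ_parg hφ hs)]
        by_cases hp : HasPair ((rename φ).getD (s / 2) [])
        · rw [decide_eq_true hp, if_pos rfl, if_pos hp]; rfl
        · rw [decide_eq_false hp, if_neg Bool.false_ne_true, if_neg hp]; rfl
      · rw [decide_eq_false h1, if_neg Bool.false_ne_true, if_neg h1]; rfl

/-- **Value of the `ρ` piece**: `frame 1^{ρ_z}`. [folklore] -/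
theorem rhoPiece_parg (z : ℕ) : rhoPiece (parg φ z) = Ladder3.frame (ones ((frm φ).rho (TT φ) (sg φ) z)) := by
  classical
  have hu := usedQ_val oneBit_cellTest (P := fun a b t => t.1 = a ∧ t.2.1 = b) cellTest_val
    (aQ := sQ) (bQ := uQ') (φ := φ) (z := z) (sQ_parg hφ z) (uQ'_parg hφ z)
  rw [rhoPiece, iteFn_apply (andFn_apply (zmodA0Q_parg hφ z) hu), CellFrame.rho]
  by_cases h : z % (frm φ).A = 0 ∧ CellUsed (TT φ) ((frm φ).m2 - 1 - z % (frm φ).W / (frm φ).A) (z / (frm φ).W)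
  · rw [if_pos h]
    have hb : (decide (z % (frm φ).A = 0) && decide (∃ t ∈ TT φ, t.1 = (frm φ).m2 - 1 - z % (frm φ).W / (frm φ).A ∧
        t.2.1 = z / (frm φ).W)) = true := by
      rw [Bool.and_eq_true, decide_eq_true_eq, decide_eq_true_eq]; exact h
    rw [hb, if_pos rfl, sigmaPiece_parg hφ h.2]
  · rw [if_neg h]
    have hb : (decide (z % (frm φ).A = 0) && decide (∃ t ∈ TT φ, t.1 = (frm φ).m2 - 1 - z % (frm φ).W / (frm φ).A ∧
        t.2.1 = z / (frm φ).W)) = false := by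
      rw [Bool.and_eq_false_iff, decide_eq_false_iff_not, decide_eq_false_iff_not, ← not_and_or]; exact h
    rw [hb, if_neg Bool.false_ne_true]; rfl

end PieceVals

/-! ### The list folds and the output -/

/-- The polynomial bounding the number of entries `r + 1 = W U ≤ 100 (|w| + 1)⁴`. [folklore] -/
def P4 : Polynomial ℕ := Polynomial.C 100 * (X + 1) ^ 4

/-- The initial record `⟨⟨w, Tcode⟩, ⟨bin (r+1), ⟨1⁰, ε⟩⟩⟩` of the list folds. [folklore] -/
def lInit : List Bool → List Bool :=
  fanoutFn ctxF (fanoutFn (lenBinF ∘ R1Of id) (fun _ => boolPair (ones 0) []))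

/-- The tabulation of a list from its entry piece: `⟨1^{r+1}, fold of the pieces⟩`. [folklore] -/
def listF (piece : List Bool → List Bool) : List Bool → List Bool :=
  fanoutFn (R1Of id) (sndPow 2 ∘ foldLoop appF (clipF 6 piece) P4 ∘ lInit)

/-- **The output on a good code**: `⟨code μ, ⟨code ν, code ρ⟩⟩`. [cite: FischerIkenmeyer2020, §6 (Problem 5)] -/
def outF : List Bool → List Bool := fanoutFn (listF muPiece) (fanoutFn (listF nuPiece) (listF rhoPiece))

/-- `lInit`: membership in `FP` by composition. [cite: AroraBarak2009, §1.3] -/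
theorem lInit_mem_FP : lInit ∈ FP :=
  fanoutFn_mem_FP ctxF_mem_FP (fanoutFn_mem_FP (comp_mem_FP lenBinF_mem_FP (R1Of_mem_FP (PolyTimeComputable.id _)))
    (const_mem_FP _))

/-- `listF piece ∈ FP` for `piece ∈ FP` (linear clip). [cite: AroraBarak2009, §1.3 (bounded loops)] -/
theorem listF_mem_FP {piece : List Bool → List Bool} (hp : piece ∈ FP) : listF piece ∈ FP :=
  fanoutFn_mem_FP (R1Of_mem_FP (PolyTimeComputable.id _)) (comp_mem_FP (sndPow_mem_FP 2) (comp_mem_FP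
    (foldLoop_clipF_mem_FP 6 appF_mem_FP length_appF_le hp _) lInit_mem_FP))

/-- **`outF ∈ FP`.** [cite: AroraBarak2009, §1.3] -/
theorem outF_mem_FP : outF ∈ FP :=
  fanoutFn_mem_FP (listF_mem_FP muPiece_mem_FP) (fanoutFn_mem_FP (listF_mem_FP nuPiece_mem_FP) (listF_mem_FP rhoPiece_mem_FP))

/-- The unary list code: `code [e₀, …, e_k] = ⟨1^{k+1}, frame 1^{e₀} ⋯ frame 1^{e_k}⟩`. [folklore] -/
theorem encodeUnaryList_eq (l : List ℕ) : encodingUnaryListNat.encode l = boolPair (ones l.length) (encList (l.map ones)) := by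
  rw [show encodingUnaryListNat = unaryEncodingNat.listBool from rfl, listBool_encode_eq_encList]
  have : l.map unaryEncodingNat.encode = l.map ones := List.map_congr_left fun e _ => unaryEncodeNat_eq_ones' e
  rw [this, unaryEncodeNat_eq_ones']

/-- The concatenated frames of a tabulation. [folklore] -/
theorem ccat_frame (f : ℕ → ℕ) (x : List Bool) {piece : List Bool → List Bool}
    (h : ∀ z, piece (boolPair x (ones z)) = Ladder3.frame (ones (f z))) : ∀ K,
    ccat (fun j => piece (boolPair x (ones j))) K = encList (((List.range K).map f).map ones)
  | 0 => by simp
  | K + 1 => by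
    rw [ccat_succ, ccat_frame f x h K, List.range_succ, List.map_append, List.map_append, encList_append, h,
      List.map_singleton, List.map_singleton, encList_cons_eq, encList_nil, List.append_nil]

/-- The frame's `r + 1` is at most `100 (|w| + 1)⁴`. [folklore] -/
theorem r_succ_le {φ : CNF ℕ} (hφ : φ.IsThreeLiteralClauses) :
    (frm φ).r + 1 ≤ P4.eval (encodingCNF.encode φ).length := by
  have hL : φ.length ≤ (encodingCNF.encode φ).length := by
    have := length_fstF_sndF_le (encodingCNF.encode φ)
    rw [encodeCNF_eq, fstF_boolPair, List.length_replicate] at this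
    rw [encodeCNF_eq]; omega
  rw [CellFrame.r_succ, frm_W hφ, frm_U hφ, P4]
  simp only [eval_mul, eval_C, eval_pow, eval_add, eval_X, eval_one]
  set L := (encodingCNF.encode φ).length
  set m := φ.length
  calc (2 * m + 1) * (6 * m + 2) * ((6 * m + 2) * m + 1)
      ≤ (2 * L + 2) * (6 * L + 6) * ((6 * L + 6) * (L + 1)) := by
        apply Nat.mul_le_mul (Nat.mul_le_mul (by omega) (by omega)); nlinarith
    _ = 72 * (L + 1) ^ 4 := by ring
    _ ≤ 100 * (L + 1) ^ 4 := Nat.mul_le_mul_right _ (by norm_num)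

/-- **Value of a tabulation on a good code**: the unary code of `[f 0, …, f r]` for a piece with
values `frame 1^{f z}`. [folklore] -/
theorem listF_encode {φ : CNF ℕ} (hφ : φ.IsThreeLiteralClauses) {piece : List Bool → List Bool} {f : ℕ → ℕ}
    (h : ∀ z, piece (parg φ z) = Ladder3.frame (ones (f z))) (hf : ∀ z, f z ≤ 2) :
    listF piece (encodingCNF.encode φ) = encodingUnaryListNat.encode ((List.range ((frm φ).r + 1)).map f) := by
  obtain ⟨K, hK⟩ : ∃ K, (frm φ).r + 1 = K := ⟨_, rfl⟩
  have hR := R1Of_val (g := id) hφ (q := encodingCNF.encode φ) rfl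
  have hk : K ≤ P4.eval (ctx φ).length := by
    rw [← hK]
    refine (r_succ_le hφ).trans ?_
    have : (encodingCNF.encode φ).length ≤ (ctx φ).length := by rw [ctx, length_boolPair]; omega
    simp only [P4, eval_mul, eval_C, eval_pow, eval_add, eval_X, eval_one]
    exact Nat.mul_le_mul_left _ (Nat.pow_le_pow_left (by omega) 4)
  rw [hK] at hR ⊢
  have hinit : lInit (encodingCNF.encode φ) = boolPair (ctx φ) (boolPair (encodeNat K) (boolPair (ones 0) [])) := by
    simp only [lInit, fanoutFn_apply, ctxF_encode hφ, Function.comp_apply, hR, lenBinF_apply, List.length_replicate]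
  rw [listF, fanoutFn_apply, hR, Function.comp_apply, Function.comp_apply, hinit, foldLoop_apply _ _ hk, foldAcc_clipF,
    foldAcc_appF, List.nil_append, encodeUnaryList_eq, List.length_map, List.length_range]
  · simp only [sndPow_succ_boolPair, sndPow_zero_boolPair, Nat.zero_add]
    rw [ccat_frame f (ctx φ) h K]
  · intro j _ _
    show (piece (parg φ j)).length ≤ 6 * ((ctx φ).length + 1)
    rw [h, length_frame, List.length_replicate]
    have := hf j; omega

/-- `μ ≤ 1`. [folklore] -/
theorem mu_le (Φ : CellFrame) (T' : Finset Inc) (x : ℕ) : Φ.mu T' x ≤ 2 := by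
  unfold CellFrame.mu; split_ifs <;> omega

/-- `ν ≤ 1`. [folklore] -/
theorem nu_le (Φ : CellFrame) (T' : Finset Inc) (y : ℕ) : Φ.nu T' y ≤ 2 := by
  unfold CellFrame.nu; split_ifs <;> omega

/-- `σ ≤ 2`. [folklore] -/
theorem sg_le (φ : CNF ℕ) (s u : ℕ) : sg φ s u ≤ 2 := by
  unfold sg sigma; split_ifs <;> omega

/-- `ρ ≤ 2`. [folklore] -/
theorem rho_le (φ : CNF ℕ) (z : ℕ) : (frm φ).rho (TT φ) (sg φ) z ≤ 2 := by
  unfold CellFrame.rho; split_ifs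
  · exact sg_le φ _ _
  · omega

/-- **Value of the output on a good code**: the code of the 2D-X-RAY instance `xrayOf φ`.
[cite: GardnerGritzmannPrangenberg1999, Lemma 3.4] [cite: FischerIkenmeyer2020, §6 (Problem 5)] -/
theorem outF_encode {φ : CNF ℕ} (hφ : φ.IsThreeLiteralClauses) :
    outF (encodingCNF.encode φ) = encodingTwoDXRay.encode (xrayOf φ) := by
  rw [outF, fanoutFn_apply, fanoutFn_apply, listF_encode hφ (muPiece_parg hφ) (mu_le _ _),
    listF_encode hφ (nuPiece_parg hφ) (nu_le _ _), listF_encode hφ (rhoPiece_parg hφ) (rho_le φ), xrayOf_eq]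
  rfl

end OneInThree

end Literature.Computability.Complexity
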